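import Summits.BirchSwinnertonDyer.BirchSwinnertonDyer.Theorems.PrintCf2SplitBadTwoRestrictedSelmerArchimedeanLocalKer
import Summits.BirchSwinnertonDyer.Rank1Residual.X11b.AnticyclotomicControlMap
import HarnessLib

/-!
# Crux `PrintCf2.SplitBadTwoRankOneOfFacts` (stmt-BirchSwinnertonDyer-20368), road α v10.3 — S3c residual (R-SURJ), file 4a:
# LOCAL SURJECTIVITY ONTO THE LOCAL KERNELS ⟹ `[A : 𝔖_𝔮(K, M)] = (∏_{w∈T} #LK_w) · #LK_𝔮` («δ = 1»), and the bridge from (LS)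

Cell `bsd-print-cf2`, width seat `bsd-line-cf2-p1-w5` g3 (prover-bsd-line-cf2-p1-w5-g3-0); lane «(R-SURJ)» of LEAD g12's residual board (cut 7 =
`restrictedControl_two_of_four_residuals'`, p668543, hypothesis (R-SURJ″)). `--supports stmt-BirchSwinnertonDyer-20368` (helper, Theses-free). HONEST
FRAMING: nothing here closes the crux or a registered stub; BSD is not proved by any of this; no summit statement is proved by this seat. No definition,
no named fact, no `sorry`.

WHAT (generic: any number field `K`, `ℤ_p`-line `κ`, discrete `Γ_K`-module `M`, place `𝔮 ∋ p`, finite set `T` of finite places away from `p`). Files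
1–3 of this lane (p668224, p668269, p670030) computed the cokernel of control EXACTLY: `[𝔖^Γ : res 𝔖_𝔮(K, M)] · #ker(res) = [A : 𝔖_𝔮(K, M)] ·
#(𝔖_𝔮(K, M) ∩ ker res)` with `A = res⁻¹(𝔖^Γ)` the lifts and `[A : 𝔖_𝔮(K, M)] ∣ (∏_{w∈T} #LK_w) · #LK_𝔮`. THIS FILE proves the EQUALITY
`[A : 𝔖_𝔮(K, M)] = (∏_{w∈T} #LK_w) · #LK_𝔮` — LEAD g12's «δ = 1» (memo `S3C-DEFECT-VANISHES-g12.md`) — from a LOCAL SURJECTIVITY hypothesis, and bridges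
-w4 g9's displayed (LS) (p668156 `baseLift_of_locSurj`: «every finitely supported family `τ_w ∈ H¹(D_w, M)` away from `p` or at `𝔮` is `res_{D_w} g`
for a `g ∈ H¹(Γ_K, M)` vanishing at the other finite places away from `p`») to it:
* `resOfLe_top_mem_restrictedSelmerZp_of_localKer` — converse of p658316's `resOfLe_decomp_mem_localKer_of_mem`: a class of `H¹(K, M)` whose local
  classes lie in the local kernels `LK_w` (finite `w ∤ p`, infinite `w`, and `𝔮`) restricts into `𝔖_𝔮(K_∞, M)`;
* **`index_lifts_eq_prod_natCard_localKer_of_locSurj`** — if every family `(y_w)_{w∈T}, y_𝔮` of local-kernel classes is realised by some `x ∈ H¹(K, M)`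
  with local classes in the local kernels elsewhere, then `[A : 𝔖_𝔮(K, M)] = (∏_{w∈T} #LK_w) · #LK_𝔮` (the local-class map `A → ∏ LK_w × LK_𝔮`, kernel
  `𝔖_𝔮(K, M)`, is onto; `A/𝔖 ≃` the product — `Nat.card`, no finiteness needed);
* **`locSurj_top_of_locSurj`** — for `K` totally complex and `p ∈ 𝔮`, (LS) in the `H¹(Γ_K, M)`/`res_{D_w}` currency implies that hypothesis in the
  `H¹(⊤, M)`/`res_{⊤⊓D_w}` currency of the control files (`res_{⊤→⊤⊓D} ∘ res_{Γ_K→⊤} = res_{D→⊤⊓D} ∘ res_{Γ_K→D}`, X11b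
  `resOfLe_top_comp_resH1Hom_subgroupIncl`; archimedean classes vanish, `D_∞ = ⊥`).
File 4b (`…RestrictedSelmerCokernelOfLocSurjFrame`) instantiates on the road-α frames: (LS) ⟹ `relIndex · 2 = ∏` ⟹ cut 7's (R-SURJ″) with `e_s ≡ −1`.
presearch: JSW17 Prop. 3.3.2 / Lemma 3.3.3 (arXiv:1512.06894 pp. 11–12), Greenberg LNM 1716 §3 Lemmas 3.2–3.3 — held; no new fact. beyond-print theorem: no.

References: [GreenbergLNM1716] §3 Lemmas 3.2–3.3 (pp. 86–88); [JetchevSkinnerWan2017] Prop. 3.3.2, Lemma 3.3.3; [Agboola2007] §3 Prop. 3.2.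
-/

noncomputable section

open scoped Classical

set_option linter.dupNamespace false
set_option autoImplicit false

open NumberField IsDedekindDomain Field
open Literature.NumberTheory.EllipticCurves Literature.NumberTheory.EllipticCurves.GreenbergSelmer
open Literature.NumberTheory.EllipticCurves.Agboola2007
open Literature.NumberTheory.EllipticCurves.IwasawaDual
open Literature.NumberTheory.EllipticCurves.ResKernel
open Literature.NumberTheory.GaloisRepresentations

universe u

namespace Summit.BirchSwinnertonDyer.BirchSwinnertonDyer.Theorems.PrintCf2.RestrictedSelmerPair

/-! ## §1. Generic: a class of `H¹(K, M)` whose local classes lie in the local kernels restricts into `𝔖_𝔮(K_∞, M)`;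
## local surjectivity onto the local kernels ⟹ `[A : 𝔖_𝔮(K, M)] = (∏_{w∈T} #LK_w) · #LK_𝔮` -/

section Generic

variable {K : Type u} [Field K] [NumberField K] {p : ℕ} [Fact p.Prime] (κ : ZpExtension K p)
  (M : Type u) [AddCommGroup M] [DistribMulAction (absoluteGaloisGroup K) M]
  [TopologicalSpace M] [DiscreteTopology M] (𝔮 : HeightOneSpectrum (𝓞 K))

/-- **Converse of `resOfLe_decomp_mem_localKer_of_mem`: a class `x ∈ H¹(K, M)` whose local classes lie in the local kernels
`LK_w = ker (H¹(⊤ ⊓ D_w, M) → H¹(ker κ ⊓ D_w, M))` at every finite `w ∤ p`, at every infinite place and at `𝔮` RESTRICTS INTO `𝔖_𝔮(K_∞, M)`.**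
(Conjugations act trivially on classes restricted from `⊤`, `conjH1_resOfLe_of_mem`; restrictions compose, `resOfLe_inf_resOfLe`.)
[cite: Agboola2007, §3 Prop. 3.2 (arXiv p0008:L128–135)] [cite: GreenbergLNM1716, §3 (the maps `r_v`, p. 86)] -/
theorem resOfLe_top_mem_restrictedSelmerZp_of_localKer (x : subgroupH1 (⊤ : Subgroup (absoluteGaloisGroup K)) M)
    (hfin : ∀ w : HeightOneSpectrum (𝓞 K), ((p : ℕ) : 𝓞 K) ∉ w.asIdeal →
      resOfLe M (inf_le_left : ⊤ ⊓ decomp w ≤ ⊤) x ∈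
        (resOfLe M (inf_le_inf_right (decomp w) (le_top : κ.kerSubgroup ≤ ⊤))).ker)
    (hinf : ∀ w : InfinitePlace K,
      resOfLe M (inf_le_left : ⊤ ⊓ decompInf w ≤ ⊤) x ∈
        (resOfLe M (inf_le_inf_right (decompInf w) (le_top : κ.kerSubgroup ≤ ⊤))).ker)
    (hq : resOfLe M (inf_le_left : ⊤ ⊓ decomp 𝔮 ≤ ⊤) x ∈
      (resOfLe M (inf_le_inf_right (decomp 𝔮) (le_top : κ.kerSubgroup ≤ ⊤))).ker) :
    resOfLe M (le_top : κ.kerSubgroup ≤ ⊤) x ∈ restrictedSelmerZp κ M 𝔮 := by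
  rw [restrictedSelmerZp, mem_restrictedSelmer_iff_resOfLe κ.kerSubgroup M p 𝔮]
  have hconj : ∀ σ : absoluteGaloisGroup K,
      conjH1 κ.kerSubgroup M σ (resOfLe M (le_top : κ.kerSubgroup ≤ ⊤) x) = resOfLe M (le_top : κ.kerSubgroup ≤ ⊤) x :=
    fun σ ↦ conjH1_resOfLe_of_mem M (le_top : κ.kerSubgroup ≤ ⊤) (Subgroup.mem_top σ) x
  refine ⟨fun w hw σ ↦ ?_, fun w σ ↦ ?_, fun σ ↦ ?_⟩
  · rw [hconj, resOfLe_inf_resOfLe M (le_top : κ.kerSubgroup ≤ ⊤)]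
    exact (AddMonoidHom.mem_ker).mp (hfin w hw)
  · rw [hconj, resOfLe_inf_resOfLe M (le_top : κ.kerSubgroup ≤ ⊤)]
    exact (AddMonoidHom.mem_ker).mp (hinf w)
  · rw [hconj, resOfLe_inf_resOfLe M (le_top : κ.kerSubgroup ≤ ⊤)]
    exact (AddMonoidHom.mem_ker).mp hq

/-- **LOCAL SURJECTIVITY ONTO THE LOCAL KERNELS ⟹ `[A : 𝔖_𝔮(K, M)] = (∏_{w∈T} #LK_w) · #LK_𝔮`** (`A = res⁻¹(𝔖^Γ)` the lifts, as in file 1/3): if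
every family `(y_w)_{w ∈ T}, y_𝔮` of local-kernel classes is the family of local classes of some `x ∈ H¹(K, M)` whose other local classes at the
finite `w ∤ p` and at infinity lie in the local kernels, then the local-class map `A → (∏_{w∈T} LK_w) × LK_𝔮` (kernel `𝔖_𝔮(K, M)`,
`mem_restrictedSelmerBase_iff_of_localKer_eq_bot`) is ONTO, so the index is the full product — the «δ = 1» of LEAD g12's memo
`S3C-DEFECT-VANISHES-g12.md`, as a kernel implication. [cite: GreenbergLNM1716, §3 Lemmas 3.2–3.3 (pp. 86–88)] [cite: Agboola2007, §3 Prop. 3.2] -/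
theorem index_lifts_eq_prod_natCard_localKer_of_locSurj (γ : absoluteGaloisGroup K) (h𝔮 : ((p : ℕ) : 𝓞 K) ∈ 𝔮.asIdeal)
    (T : Finset (HeightOneSpectrum (𝓞 K))) (hTp : ∀ w ∈ T, ((p : ℕ) : 𝓞 K) ∉ w.asIdeal)
    (hT0 : ∀ w : HeightOneSpectrum (𝓞 K), ((p : ℕ) : 𝓞 K) ∉ w.asIdeal → w ∉ T →
      (resOfLe M (inf_le_inf_right (decomp w) (le_top : κ.kerSubgroup ≤ ⊤))).ker = ⊥)
    (hinf : ∀ w : InfinitePlace K, (resOfLe M (inf_le_inf_right (decompInf w) (le_top : κ.kerSubgroup ≤ ⊤))).ker = ⊥)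
    (hLS : ∀ y : (w : HeightOneSpectrum (𝓞 K)) → subgroupH1 ((⊤ : Subgroup (absoluteGaloisGroup K)) ⊓ decomp w) M,
      (∀ w ∈ T, y w ∈ (resOfLe M (inf_le_inf_right (decomp w) (le_top : κ.kerSubgroup ≤ ⊤))).ker) →
      y 𝔮 ∈ (resOfLe M (inf_le_inf_right (decomp 𝔮) (le_top : κ.kerSubgroup ≤ ⊤))).ker →
      ∃ x : subgroupH1 (⊤ : Subgroup (absoluteGaloisGroup K)) M,
        (∀ w ∈ T, resOfLe M (inf_le_left : ⊤ ⊓ decomp w ≤ ⊤) x = y w) ∧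
        resOfLe M (inf_le_left : ⊤ ⊓ decomp 𝔮 ≤ ⊤) x = y 𝔮 ∧
        (∀ w : HeightOneSpectrum (𝓞 K), ((p : ℕ) : 𝓞 K) ∉ w.asIdeal → w ∉ T →
          resOfLe M (inf_le_left : ⊤ ⊓ decomp w ≤ ⊤) x ∈
            (resOfLe M (inf_le_inf_right (decomp w) (le_top : κ.kerSubgroup ≤ ⊤))).ker) ∧
        (∀ w : InfinitePlace K, resOfLe M (inf_le_left : ⊤ ⊓ decompInf w ≤ ⊤) x ∈
            (resOfLe M (inf_le_inf_right (decompInf w) (le_top : κ.kerSubgroup ≤ ⊤))).ker)) :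
    ((restrictedSelmerBase M p 𝔮).addSubgroupOf
        (((endInvariants (conjRestricted κ M 𝔮 γ - 1)).map (restrictedSelmerZp κ M 𝔮).subtype).comap
          (resOfLe M (le_top : κ.kerSubgroup ≤ ⊤)))).index =
      (∏ w ∈ T, Nat.card (resOfLe M (inf_le_inf_right (decomp w) (le_top : κ.kerSubgroup ≤ ⊤))).ker) *
        Nat.card (resOfLe M (inf_le_inf_right (decomp 𝔮) (le_top : κ.kerSubgroup ≤ ⊤))).ker := by
  set H := κ.kerSubgroup with hHdef
  set f : subgroupH1 (⊤ : Subgroup (absoluteGaloisGroup K)) M →+ subgroupH1 H M := resOfLe M (le_top : H ≤ ⊤) with hfdef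
  set S := restrictedSelmerZp κ M 𝔮 with hSdef
  set E : AddSubgroup S := endInvariants (conjRestricted κ M 𝔮 γ - 1) with hEdef
  set SK := restrictedSelmerBase M p 𝔮 with hSKdef
  set A : AddSubgroup (subgroupH1 (⊤ : Subgroup (absoluteGaloisGroup K)) M) := (E.map S.subtype).comap f with hAdef
  have hAS : ∀ x ∈ A, f x ∈ S := by
    rintro x ⟨e, -, hex⟩
    rw [← hex]; exact e.2
  have hmemA : ∀ (x) (hS : f x ∈ S), (⟨f x, hS⟩ : S) ∈ E → x ∈ A := fun x hS hE ↦ ⟨⟨f x, hS⟩, hE, rfl⟩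
  -- membership in `A` from local conditions
  have hmemA' : ∀ x : subgroupH1 (⊤ : Subgroup (absoluteGaloisGroup K)) M,
      (∀ w : HeightOneSpectrum (𝓞 K), ((p : ℕ) : 𝓞 K) ∉ w.asIdeal →
        resOfLe M (inf_le_left : ⊤ ⊓ decomp w ≤ ⊤) x ∈ (resOfLe M (inf_le_inf_right (decomp w) (le_top : H ≤ ⊤))).ker) →
      (∀ w : InfinitePlace K, resOfLe M (inf_le_left : ⊤ ⊓ decompInf w ≤ ⊤) x ∈
        (resOfLe M (inf_le_inf_right (decompInf w) (le_top : H ≤ ⊤))).ker) →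
      resOfLe M (inf_le_left : ⊤ ⊓ decomp 𝔮 ≤ ⊤) x ∈ (resOfLe M (inf_le_inf_right (decomp 𝔮) (le_top : H ≤ ⊤))).ker →
      x ∈ A := by
    intro x h1 h2 h3
    have hxS : f x ∈ S := resOfLe_top_mem_restrictedSelmerZp_of_localKer κ M 𝔮 x h1 h2 h3
    refine hmemA x hxS ?_
    rw [hEdef, mem_endInvariants_conjRestricted_iff]
    exact conjH1_resOfLe_of_mem M (le_top : H ≤ ⊤) (Subgroup.mem_top γ) x
  set B : AddSubgroup A := SK.addSubgroupOf A with hBdef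
  -- the local-class map `φ : A → (∏_{w ∈ T} LK_w) × LK_𝔮`, kernel `B` (as in file 1/3)
  let LK : (w : HeightOneSpectrum (𝓞 K)) →
      AddSubgroup (subgroupH1 ((⊤ : Subgroup (absoluteGaloisGroup K)) ⊓ decomp w) M) := fun w ↦
    (resOfLe M (inf_le_inf_right (decomp w) (le_top : H ≤ ⊤))).ker
  have hloc : ∀ (x : A) (w : HeightOneSpectrum (𝓞 K)), ((p : ℕ) : 𝓞 K) ∉ w.asIdeal ∨ w = 𝔮 →
      resOfLe M (inf_le_left : ⊤ ⊓ decomp w ≤ ⊤) (x : subgroupH1 ⊤ M) ∈ LK w := by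
    intro x w hw
    obtain ⟨hfin', -, hq⟩ := resOfLe_decomp_mem_localKer_of_mem κ M 𝔮 (hAS x x.2)
    rcases hw with hw | rfl
    · exact hfin' w hw
    · exact hq
  let G := subgroupH1 (⊤ : Subgroup (absoluteGaloisGroup K)) M
  let locw : (w : HeightOneSpectrum (𝓞 K)) →
      (G →+ subgroupH1 ((⊤ : Subgroup (absoluteGaloisGroup K)) ⊓ decomp w) M) := fun w ↦
    resOfLe M (inf_le_left : ⊤ ⊓ decomp w ≤ ⊤)
  let φ : A →+ (Π w : ↥T, LK (w : HeightOneSpectrum (𝓞 K))) × LK 𝔮 :=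
    { toFun := fun x ↦ (fun w ↦ ⟨locw w (x : G), hloc x w (Or.inl (hTp w w.2))⟩, ⟨locw 𝔮 (x : G), hloc x 𝔮 (Or.inr rfl)⟩)
      map_zero' := by
        refine Prod.ext (funext fun w ↦ Subtype.ext ?_) (Subtype.ext ?_)
        · show locw w ((0 : A) : G) = ((0 : LK (w : HeightOneSpectrum (𝓞 K))) :
            subgroupH1 ((⊤ : Subgroup (absoluteGaloisGroup K)) ⊓ decomp (w : HeightOneSpectrum (𝓞 K))) M)
          rw [ZeroMemClass.coe_zero, map_zero, ZeroMemClass.coe_zero]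
        · show locw 𝔮 ((0 : A) : G) = ((0 : LK 𝔮) : subgroupH1 ((⊤ : Subgroup (absoluteGaloisGroup K)) ⊓ decomp 𝔮) M)
          rw [ZeroMemClass.coe_zero, map_zero, ZeroMemClass.coe_zero]
      map_add' := fun a b ↦ by
        refine Prod.ext (funext fun w ↦ Subtype.ext ?_) (Subtype.ext ?_)
        · show locw w ((a : G) + (b : G)) = locw w (a : G) + locw w (b : G)
          exact map_add _ _ _
        · show locw 𝔮 ((a : G) + (b : G)) = locw 𝔮 (a : G) + locw 𝔮 (b : G)
          exact map_add _ _ _ }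
  have hφ1 : ∀ (x : A) (w : ↥T), (((φ x).1 w : LK (w : HeightOneSpectrum (𝓞 K))) :
      subgroupH1 ((⊤ : Subgroup (absoluteGaloisGroup K)) ⊓ decomp (w : HeightOneSpectrum (𝓞 K))) M) =
      resOfLe M (inf_le_left : ⊤ ⊓ decomp (w : HeightOneSpectrum (𝓞 K)) ≤ ⊤) (x : G) := fun _ _ ↦ rfl
  have hφ2 : ∀ x : A, (((φ x).2 : LK 𝔮) : subgroupH1 ((⊤ : Subgroup (absoluteGaloisGroup K)) ⊓ decomp 𝔮) M) =
      resOfLe M (inf_le_left : ⊤ ⊓ decomp 𝔮 ≤ ⊤) (x : G) := fun _ ↦ rfl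
  have hkerφ : φ.ker = B := by
    ext x
    rw [AddMonoidHom.mem_ker, hBdef, AddSubgroup.mem_addSubgroupOf,
      mem_restrictedSelmerBase_iff_of_localKer_eq_bot κ M 𝔮 T hT0 hinf (hAS x x.2)]
    constructor
    · intro h0
      refine ⟨fun w hwT _ ↦ ?_, ?_⟩
      · rw [← hφ1 x ⟨w, hwT⟩, h0]; rfl
      · rw [← hφ2 x, h0]; rfl
    · rintro ⟨h1, h2⟩
      refine Prod.ext (funext fun w ↦ Subtype.ext ?_) (Subtype.ext ?_)
      · rw [hφ1]; exact h1 w w.2 (hTp w w.2)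
      · rw [hφ2]; exact h2
  -- `φ` is onto, by (LS)
  have hqT : 𝔮 ∉ T := fun h ↦ hTp 𝔮 h h𝔮
  have hφsurj : Function.Surjective φ := by
    rintro ⟨yT, yq⟩
    -- the uniform family of prescribed local classes (zero off `T ∪ {𝔮}`)
    let y : (w : HeightOneSpectrum (𝓞 K)) → subgroupH1 ((⊤ : Subgroup (absoluteGaloisGroup K)) ⊓ decomp w) M := fun w ↦
      if hw : w ∈ T then ((yT ⟨w, hw⟩ : LK w) : subgroupH1 ((⊤ : Subgroup (absoluteGaloisGroup K)) ⊓ decomp w) M)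
      else if hq : w = 𝔮 then hq ▸ ((yq : LK 𝔮) : subgroupH1 ((⊤ : Subgroup (absoluteGaloisGroup K)) ⊓ decomp 𝔮) M)
      else 0
    have hyT : ∀ w : ↥T, y w = ((yT w : LK w) : subgroupH1 ((⊤ : Subgroup (absoluteGaloisGroup K)) ⊓ decomp (w : HeightOneSpectrum (𝓞 K))) M) :=
      fun w ↦ by simp only [y, dif_pos w.2]
    have hyq : y 𝔮 = ((yq : LK 𝔮) : subgroupH1 ((⊤ : Subgroup (absoluteGaloisGroup K)) ⊓ decomp 𝔮) M) := by
      simp only [y, dif_neg hqT]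
      exact dif_pos trivial
    obtain ⟨x, hxT, hxq, hx0, hxinf⟩ := hLS y (fun w hw ↦ by rw [hyT ⟨w, hw⟩]; exact (yT ⟨w, hw⟩).2)
      (by rw [hyq]; exact yq.2)
    have hxA : x ∈ A := by
      refine hmemA' x (fun w hw ↦ ?_) hxinf (by rw [hxq, hyq]; exact yq.2)
      by_cases hwT : w ∈ T
      · rw [hxT w hwT, hyT ⟨w, hwT⟩]; exact (yT ⟨w, hwT⟩).2
      · exact hx0 w hw hwT
    refine ⟨⟨x, hxA⟩, Prod.ext (funext fun w ↦ Subtype.ext ?_) (Subtype.ext ?_)⟩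
    · rw [hφ1]; exact (hxT w w.2).trans (hyT w)
    · rw [hφ2]; exact hxq.trans hyq
  -- counting (no finiteness needed: `A / 𝔖_𝔮(K, M) ≃ (∏_{w∈T} LK_w) × LK_𝔮`)
  have hcardP : Nat.card ((Π w : ↥T, LK (w : HeightOneSpectrum (𝓞 K))) × LK 𝔮) =
      (∏ w ∈ T, Nat.card (LK w)) * Nat.card (LK 𝔮) := by
    rw [Nat.card_prod, Nat.card_pi, ← Finset.prod_coe_sort T (fun w ↦ Nat.card (LK w))]
  rw [← hcardP, ← hkerφ, AddSubgroup.index_eq_card]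
  exact Nat.card_congr (QuotientAddGroup.quotientKerEquivOfSurjective φ hφsurj).toEquiv

/-- **Bridge from the `H¹(Γ_K, M)` / `res_{D_w}` currency of (LS)** (-w4 g9's `baseLift_of_locSurj`, p668156: «for every finite set `S` of finite
places away from `p` or equal to `𝔮`, every family `τ_w ∈ H¹(D_w, M)` is `res_{D_w} g` on `S` for some `g ∈ H¹(Γ_K, M)` with `res_{D_w} g = 0` at the
finite `w ∉ S` away from `p`») **to the `H¹(⊤, M)` / `res_{⊤ ⊓ D_w}` currency of the control files**, for a totally complex `K` (the archimedean
classes vanish: `D_w = ⊥`) and `p ∈ 𝔮`: the hypothesis `hLS` of `index_lifts_eq_prod_natCard_localKer_of_locSurj` holds for every finite `T` away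
from `p`. (Transport: `res_{⊤→⊤⊓D} ∘ res_{Γ_K→⊤} = res_{D→⊤⊓D} ∘ res_{Γ_K→D}`, one compatible pair each; `⊤ ⊓ D_w = D_w`.)
[cite: JetchevSkinnerWan2017, Prop. 3.3.2 (arXiv:1512.06894 p. 11)] [cite: GreenbergLNM1716, §3 p. 87] -/
theorem locSurj_top_of_locSurj [IsTotallyComplex K] (h𝔮 : ((p : ℕ) : 𝓞 K) ∈ 𝔮.asIdeal)
    (hLS : ∀ (S : Finset (HeightOneSpectrum (𝓞 K))), (∀ w ∈ S, ((p : ℕ) : 𝓞 K) ∉ w.asIdeal ∨ w = 𝔮) →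
      ∀ τ : (w : HeightOneSpectrum (𝓞 K)) → subgroupH1 (decomp (K := K) w) M,
      ∃ g : discreteH1 (absoluteGaloisGroup K) M,
        (∀ w ∈ S, ResKernel.resSubgroup (decomp (K := K) w) M g = τ w) ∧
        (∀ w : HeightOneSpectrum (𝓞 K), w ∉ S → ((p : ℕ) : 𝓞 K) ∉ w.asIdeal →
          ResKernel.resSubgroup (decomp (K := K) w) M g = 0))
    (T : Finset (HeightOneSpectrum (𝓞 K))) (hTp : ∀ w ∈ T, ((p : ℕ) : 𝓞 K) ∉ w.asIdeal)
    (y : (w : HeightOneSpectrum (𝓞 K)) → subgroupH1 ((⊤ : Subgroup (absoluteGaloisGroup K)) ⊓ decomp w) M) :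
    ∃ x : subgroupH1 (⊤ : Subgroup (absoluteGaloisGroup K)) M,
      (∀ w ∈ T, resOfLe M (inf_le_left : ⊤ ⊓ decomp w ≤ ⊤) x = y w) ∧
      resOfLe M (inf_le_left : ⊤ ⊓ decomp 𝔮 ≤ ⊤) x = y 𝔮 ∧
      (∀ w : HeightOneSpectrum (𝓞 K), ((p : ℕ) : 𝓞 K) ∉ w.asIdeal → w ∉ T →
        resOfLe M (inf_le_left : ⊤ ⊓ decomp w ≤ ⊤) x ∈
          (resOfLe M (inf_le_inf_right (decomp w) (le_top : κ.kerSubgroup ≤ ⊤))).ker) ∧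
      (∀ w : InfinitePlace K, resOfLe M (inf_le_left : ⊤ ⊓ decompInf w ≤ ⊤) x ∈
          (resOfLe M (inf_le_inf_right (decompInf w) (le_top : κ.kerSubgroup ≤ ⊤))).ker) := by
  -- transport `H¹(⊤ ⊓ D, M) → H¹(D, M)` along `D ≤ ⊤ ⊓ D`, inverse to the restriction along `⊤ ⊓ D ≤ D`
  have hDle : ∀ D : Subgroup (absoluteGaloisGroup K), D ≤ (⊤ : Subgroup (absoluteGaloisGroup K)) ⊓ D :=
    fun D ↦ le_inf le_top le_rfl
  have hback : ∀ (D : Subgroup (absoluteGaloisGroup K)) (z : subgroupH1 ((⊤ : Subgroup (absoluteGaloisGroup K)) ⊓ D) M),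
      resOfLe M (inf_le_right : (⊤ : Subgroup (absoluteGaloisGroup K)) ⊓ D ≤ D) (resOfLe M (hDle D) z) = z := fun D z ↦ by
    rw [← AddMonoidHom.comp_apply, resOfLe_comp_holds, resOfLe_refl_holds, AddMonoidHom.id_apply]
  -- `res_{⊤→⊤⊓D} ∘ res_{Γ_K→⊤} = res_{D→⊤⊓D} ∘ res_{Γ_K→D}`
  have hsq : ∀ (D : Subgroup (absoluteGaloisGroup K)) (g : discreteH1 (absoluteGaloisGroup K) M),
      resOfLe M (inf_le_left : (⊤ : Subgroup (absoluteGaloisGroup K)) ⊓ D ≤ ⊤)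
        (resH1Hom (Literature.NumberTheory.EllipticCurves.subgroupIncl (⊤ : Subgroup (absoluteGaloisGroup K)))
          (AddMonoidHom.id M) (fun _ _ ↦ rfl) g) =
      resOfLe M (inf_le_right : (⊤ : Subgroup (absoluteGaloisGroup K)) ⊓ D ≤ D) (ResKernel.resSubgroup D M g) := by
    intro D g
    have h1 := congrArg (fun F ↦ F g)
      (Summit.BirchSwinnertonDyer.Rank1Residual.X11b.AcSelmer.resOfLe_top_comp_resH1Hom_subgroupIncl
        (H := (⊤ : Subgroup (absoluteGaloisGroup K)) ⊓ D) (M := M))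
    have h2 : (resOfLe M (inf_le_right : (⊤ : Subgroup (absoluteGaloisGroup K)) ⊓ D ≤ D)).comp (ResKernel.resSubgroup D M) =
        ResKernel.resSubgroup ((⊤ : Subgroup (absoluteGaloisGroup K)) ⊓ D) M := by
      rw [resOfLe, ResKernel.resSubgroup, ResKernel.resSubgroup, resH1Hom_comp]
      exact resH1Hom_congr (by ext; rfl) (by ext; rfl) _ _
    have h2' := congrArg (fun F ↦ F g) h2
    simp only [AddMonoidHom.coe_comp, Function.comp_apply] at h1 h2'
    rw [h1, h2']
  -- the family
  set S : Finset (HeightOneSpectrum (𝓞 K)) := insert 𝔮 T with hSdef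
  have hSp : ∀ w ∈ S, ((p : ℕ) : 𝓞 K) ∉ w.asIdeal ∨ w = 𝔮 := by
    intro w hw
    rcases Finset.mem_insert.mp hw with rfl | hw'
    · exact Or.inr rfl
    · exact Or.inl (hTp w hw')
  let τ : (w : HeightOneSpectrum (𝓞 K)) → subgroupH1 (decomp (K := K) w) M := fun w ↦ resOfLe M (hDle (decomp w)) (y w)
  obtain ⟨g, hgS, hg0⟩ := hLS S hSp τ
  set x := resH1Hom (Literature.NumberTheory.EllipticCurves.subgroupIncl (⊤ : Subgroup (absoluteGaloisGroup K)))
    (AddMonoidHom.id M) (fun _ _ ↦ rfl) g with hx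
  refine ⟨x, fun w hw ↦ ?_, ?_, fun w hpw hwT ↦ ?_, fun w ↦ ?_⟩
  · rw [hsq, hgS w (Finset.mem_insert_of_mem hw)]
    exact hback (decomp w) (y w)
  · rw [hsq, hgS 𝔮 (Finset.mem_insert_self 𝔮 T)]
    exact hback (decomp 𝔮) (y 𝔮)
  · have hwq : w ≠ 𝔮 := fun h ↦ hpw (h ▸ h𝔮)
    have hwS : w ∉ S := fun h ↦ by
      rcases Finset.mem_insert.mp h with h | h
      · exact hwq h
      · exact hwT h
    rw [hsq, hg0 w hwS hpw, map_zero]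
    exact AddSubgroup.zero_mem _
  · have hle : (⊤ : Subgroup (absoluteGaloisGroup K)) ⊓ decompInf w ≤ ⊥ := by
      rw [BigGaloisRep.decompInf_eq_bot_of_isComplex (IsTotallyComplex.isComplex w), inf_bot_eq]
    rw [subgroupH1_eq_zero_of_le_bot M hle (resOfLe M (inf_le_left : ⊤ ⊓ decompInf w ≤ ⊤) x)]
    exact AddSubgroup.zero_mem _

end Generic

end Summit.BirchSwinnertonDyer.BirchSwinnertonDyer.Theorems.PrintCf2.RestrictedSelmerPair

end
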